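import Literature.Probability.RandomPlanarGeometry.HexSAWBrickWallSlabInsertionCore
import Literature.Probability.RandomPlanarGeometry.HexSAWBrickWallStripInsertion
import HarnessLib

/-!
# The double-row insertion on the column slabs of the brick wall (the injection behind `μ(Slab_H) < μ(Slab_{H+1})`)

Topic `Literature/Probability/RandomPlanarGeometry` (the coordinate-0 twin of `HexSAWBrickWallStripInsertion.lean`; continues
`HexSAWBrickWallSlabCuts.lean` — the parity-admissible ROW cuts `HexBW.admissibleSlabCuts H a υ n` (`r + H` even) of a walk of the
column slab `Slab_H = {0,…,H} × ℤ` — and `HexSAWBrickWallSlabInsertionCore.lean` — ANY insertion with per-cut cost `≤ 2H+4` mapping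
(walk of `Slab_H`, subset of its admissible cuts) injectively to walks of `Slab_{H+1}` of length `n + Σ cost` proves
`μ(Slab_H) < μ(Slab_{H+1})` with margin).  Statement shape: N. Madras, G. Slade, *The Self-Avoiding Walk* (1993), §8.2,
Theorem 8.2.1 (8.2.13); the construction is the lane's (door R100 «HEX-ARMCHAIR-SLAB-SUBCRIT», a-p5 g7 design `R100-DESIGN.md`,
refute-first cell `slab_insert_check.py` PASS on 407 508 (walk, cut-set) pairs).

## The insertion

Given a walk `ω` of `Slab_H` and `R ⊆ admissibleSlabCuts`, the image is built block by block along `ω`: the ROW map `σ` fixes the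
start row and opens TWO fresh rows after every cut `r ∈ R` (`σ(y+1) − σ(y) = 1 + 2·[y ∈ R]`; even shifts keep brick-wall bonds and
the slab); every strand of `ω` crossing a cut `r ∈ R` at column `x` (necessarily `x + r` even) is replaced by the U-TURN
`(x,s) → (x,s+1) → (x+1,s+1) → (x+1,s+2) → (x,s+2) → (x,s+3)` (`s = σ r`, `+4` steps), except the RIGHTMOST strand of the cut
(column `x*`), whose U-turn goes all the way to the NEW COLUMN `H + 1`: `(x*,s+1) → … → (H+1,s+1) → (H+1,s+2) → … → (x*,s+2)`
(`2(H+1−x*)+2` extra steps; the bond `(H+1,s+1)–(H+1,s+2)` needs `H + s` even, which is the admissibility `r + H` even).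
-/

noncomputable section

open Finset Literature.Probability.LatticeModels Literature.Probability.Percolation SimpleGraph

namespace Literature.Probability.RandomPlanarGeometry.SAW.HexBW

namespace SlabInsertion

open StripInsertion

/-! ### The row map `σ` (base row `y₀`, two rows inserted after each cut of `R`) -/

/-- The row map of the insertion at the cuts `R` with base row `y₀`: `σ(y₀) = y₀` and `σ(y+1) − σ(y) = 3` if `y ∈ R`
(two rows inserted after row `y`), `= 1` otherwise. [cite: MadrasSlade1993, Theorem 8.2.1 (8.2.13), p. 269 (statement shape; lane construction)] -/
def rowMap (y₀ : ℤ) (R : Finset ℤ) (y : ℤ) : ℤ :=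
  y + 2 * ∑ c ∈ R, ((if c < y then (1 : ℤ) else 0) - (if c < y₀ then (1 : ℤ) else 0))

/-- `σ(y₀) = y₀`. [cite: MadrasSlade1993, Theorem 8.2.1 (8.2.13), p. 269 (statement shape; lane construction)] -/
theorem rowMap_base (y₀ : ℤ) (R : Finset ℤ) : rowMap y₀ R y₀ = y₀ := by
  simp [rowMap]

/-- `σ(y) = y + 2k` (so `σ` preserves parities). [cite: MadrasSlade1993, Theorem 8.2.1 (8.2.13), p. 269 (statement shape; lane construction)] -/
theorem rowMap_eq_add (y₀ : ℤ) (R : Finset ℤ) (y : ℤ) : ∃ k : ℤ, rowMap y₀ R y = y + 2 * k := ⟨_, rfl⟩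

/-- The increment of `σ`: `σ(y+1) = σ(y) + 1 + 2·[y ∈ R]`. [cite: MadrasSlade1993, Theorem 8.2.1 (8.2.13), p. 269 (statement shape; lane construction)] -/
theorem rowMap_succ (y₀ : ℤ) (R : Finset ℤ) (y : ℤ) :
    rowMap y₀ R (y + 1) = rowMap y₀ R y + 1 + 2 * (if y ∈ R then 1 else 0) := by
  have key : ∀ c : ℤ, ((if c < y + 1 then (1 : ℤ) else 0) - (if c < y₀ then (1 : ℤ) else 0)) =
      ((if c < y then (1 : ℤ) else 0) - (if c < y₀ then (1 : ℤ) else 0)) + (if c = y then 1 else 0) := by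
    intro c
    split_ifs <;> first | contradiction | omega
  simp only [rowMap]
  rw [Finset.sum_congr rfl fun c _ => key c, Finset.sum_add_distrib, Finset.sum_ite_eq']
  ring

/-- `σ(y+1) = σ(y) + 3` for `y ∈ R`. [cite: MadrasSlade1993, Theorem 8.2.1 (8.2.13), p. 269 (statement shape; lane construction)] -/
theorem rowMap_succ_of_mem {y₀ : ℤ} {R : Finset ℤ} {y : ℤ} (hy : y ∈ R) :
    rowMap y₀ R (y + 1) = rowMap y₀ R y + 3 := by
  rw [rowMap_succ, if_pos hy]; ring

/-- `σ(y+1) = σ(y) + 1` for `y ∉ R`. [cite: MadrasSlade1993, Theorem 8.2.1 (8.2.13), p. 269 (statement shape; lane construction)] -/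
theorem rowMap_succ_of_not_mem {y₀ : ℤ} {R : Finset ℤ} {y : ℤ} (hy : y ∉ R) :
    rowMap y₀ R (y + 1) = rowMap y₀ R y + 1 := by
  rw [rowMap_succ, if_neg hy]; ring

/-- `σ` increases at every step. [cite: MadrasSlade1993, Theorem 8.2.1 (8.2.13), p. 269 (statement shape; lane construction)] -/
theorem rowMap_lt_succ (y₀ : ℤ) (R : Finset ℤ) (y : ℤ) : rowMap y₀ R y < rowMap y₀ R (y + 1) := by
  rw [rowMap_succ]; split_ifs <;> first | contradiction | omega

/-- `σ` is strictly increasing. [cite: MadrasSlade1993, Theorem 8.2.1 (8.2.13), p. 269 (statement shape; lane construction)] -/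
theorem rowMap_strictMono (y₀ : ℤ) (R : Finset ℤ) : StrictMono (rowMap y₀ R) :=
  strictMono_int_of_lt_succ (rowMap_lt_succ y₀ R)

/-- `σ` is injective. [cite: MadrasSlade1993, Theorem 8.2.1 (8.2.13), p. 269 (statement shape; lane construction)] -/
theorem rowMap_injective (y₀ : ℤ) (R : Finset ℤ) : Function.Injective (rowMap y₀ R) :=
  (rowMap_strictMono y₀ R).injective

/-- `σ` reflects and preserves `≤`. [cite: MadrasSlade1993, Theorem 8.2.1 (8.2.13), p. 269 (statement shape; lane construction)] -/
theorem rowMap_le_iff (y₀ : ℤ) (R : Finset ℤ) {x y : ℤ} : rowMap y₀ R x ≤ rowMap y₀ R y ↔ x ≤ y :=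
  (rowMap_strictMono y₀ R).le_iff_le

/-- The two inserted rows `σ c + 1, σ c + 2` after a cut `c ∈ R` are not in the range of `σ`.
[cite: MadrasSlade1993, Theorem 8.2.1 (8.2.13), p. 269 (statement shape; lane construction)] -/
theorem rowMap_ne_ins {y₀ : ℤ} {R : Finset ℤ} {c : ℤ} (hc : c ∈ R) (y : ℤ) {j : ℤ} (hj1 : 1 ≤ j)
    (hj2 : j ≤ 2) : rowMap y₀ R y ≠ rowMap y₀ R c + j := by
  intro h
  rcases le_or_gt y c with hyc | hyc
  · have := (rowMap_le_iff y₀ R).2 hyc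
    omega
  · have h1 : c + 1 ≤ y := hyc
    have := (rowMap_le_iff y₀ R).2 h1
    rw [rowMap_succ_of_mem hc] at this
    omega

/-- Inserted rows of distinct cuts are distinct. [cite: MadrasSlade1993, Theorem 8.2.1 (8.2.13), p. 269 (statement shape; lane construction)] -/
theorem ins_ne_ins {y₀ : ℤ} {R : Finset ℤ} {c c' : ℤ} (hc : c ∈ R) (hc' : c' ∈ R) (hcc : c ≠ c')
    {j j' : ℤ} (hj1 : 1 ≤ j) (hj2 : j ≤ 2) (hj1' : 1 ≤ j') (hj2' : j' ≤ 2) :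
    rowMap y₀ R c + j ≠ rowMap y₀ R c' + j' := by
  intro h
  rcases lt_or_gt_of_ne hcc with hlt | hlt
  · have h1 : c + 1 ≤ c' := hlt
    have := (rowMap_le_iff y₀ R).2 h1
    rw [rowMap_succ_of_mem hc] at this
    omega
  · have h1 : c' + 1 ≤ c := hlt
    have := (rowMap_le_iff y₀ R).2 h1
    rw [rowMap_succ_of_mem hc'] at this
    omega

/-- The induced map on sites (rows moved, columns kept). [cite: MadrasSlade1993, Theorem 8.2.1 (8.2.13), p. 269 (statement shape; lane construction)] -/
def vmap (y₀ : ℤ) (R : Finset ℤ) (p : Site 2) : Site 2 := mk (p 0) (rowMap y₀ R (p 1))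

/-- The column of `vmap`. [cite: MadrasSlade1993, Theorem 8.2.1 (8.2.13), p. 269 (statement shape; lane construction)] -/
@[simp] theorem vmap_zero (y₀ : ℤ) (R : Finset ℤ) (p : Site 2) : vmap y₀ R p 0 = p 0 := rfl
/-- The row of `vmap`. [cite: MadrasSlade1993, Theorem 8.2.1 (8.2.13), p. 269 (statement shape; lane construction)] -/
@[simp] theorem vmap_one (y₀ : ℤ) (R : Finset ℤ) (p : Site 2) : vmap y₀ R p 1 = rowMap y₀ R (p 1) := rfl

/-- `vmap` is injective. [cite: MadrasSlade1993, Theorem 8.2.1 (8.2.13), p. 269 (statement shape; lane construction)] -/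
theorem vmap_injective (y₀ : ℤ) (R : Finset ℤ) : Function.Injective (vmap y₀ R) := by
  intro p q h
  have h0 : p 0 = q 0 := by simpa using congrFun h 0
  have h1 : rowMap y₀ R (p 1) = rowMap y₀ R (q 1) := by simpa using congrFun h 1
  rw [eq_mk p, eq_mk q, rowMap_injective y₀ R h1, h0]

/-- `vmap` fixes the sites of the base row. [cite: MadrasSlade1993, Theorem 8.2.1 (8.2.13), p. 269 (statement shape; lane construction)] -/
theorem vmap_eq_self_of_row {y₀ : ℤ} (R : Finset ℤ) {p : Site 2} (hp : p 1 = y₀) : vmap y₀ R p = p := by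
  rw [eq_mk p, hp]; unfold vmap; simp [rowMap_base]

/-- `vmap` carries brick-wall bonds between sites of consecutive NON-cut rows, or of one row, to brick-wall bonds
(the shift is even, so parities are kept). [cite: MadrasSlade1993, Theorem 8.2.1 (8.2.13), p. 269 (statement shape; lane construction)] -/
theorem adj_vmap_of_adj {y₀ : ℤ} {R : Finset ℤ} {p q : Site 2} (h : brickWallGraph.Adj p q)
    (hpq : p 1 ≠ q 1 → min (p 1) (q 1) ∉ R) : brickWallGraph.Adj (vmap y₀ R p) (vmap y₀ R q) := by
  obtain ⟨k, hk⟩ := rowMap_eq_add y₀ R (p 1)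
  obtain ⟨k', hk'⟩ := rowMap_eq_add y₀ R (q 1)
  unfold vmap
  rw [adj_mk_iff]
  rw [brickWallGraph_adj_coord] at h
  rcases h with ⟨h0, h1⟩ | ⟨h0, ⟨h1, hp⟩ | ⟨h1, hp⟩⟩
  · left
    rw [h1]
    exact ⟨h0, rfl⟩
  · have hn : p 1 ∉ R := by have := hpq (by omega); rwa [min_eq_left (by omega)] at this
    have := rowMap_succ_of_not_mem (y₀ := y₀) hn
    rw [← h1] at this
    right; exact ⟨h0, Or.inl ⟨this, by omega⟩⟩
  · have hn : q 1 ∉ R := by have := hpq (by omega); rwa [min_eq_right (by omega)] at this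
    have := rowMap_succ_of_not_mem (y₀ := y₀) hn
    rw [← h1] at this
    right; exact ⟨h0, Or.inr ⟨this, by omega⟩⟩

/-! ### The shape of a U-turn (indices `i < 2m + 2`; `m` columns to the right) -/

/-- Column offset of the `i`-th point of a U-turn of width `m`. [cite: MadrasSlade1993, Theorem 8.2.1 (8.2.13), p. 269 (statement shape; lane construction)] -/
def ucol (m i : ℕ) : ℕ := if i ≤ m then i else 2 * m + 1 - i

/-- Row offset (`1` on the way out, `2` on the way back) of the `i`-th point of a U-turn of width `m`.
[cite: MadrasSlade1993, Theorem 8.2.1 (8.2.13), p. 269 (statement shape; lane construction)] -/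
def urow (m i : ℕ) : ℕ := if i ≤ m then 1 else 2

/-- Range of the shape. [cite: MadrasSlade1993, Theorem 8.2.1 (8.2.13), p. 269 (statement shape; lane construction)] -/
theorem ushape_range {m i : ℕ} (hi : i < 2 * m + 2) : ucol m i ≤ m ∧ 1 ≤ urow m i ∧ urow m i ≤ 2 := by
  unfold ucol urow; split_ifs <;> omega

/-- Column `m` is reached exactly at `i = m` and `i = m + 1`. [cite: MadrasSlade1993, Theorem 8.2.1 (8.2.13), p. 269 (statement shape; lane construction)] -/
theorem ucol_eq_iff {m i : ℕ} (hi : i < 2 * m + 2) : ucol m i = m ↔ i = m ∨ i = m + 1 := by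
  unfold ucol; split_ifs <;> omega

/-- Consecutive points of a U-turn are brick-wall neighbours (as offsets): a horizontal step, or the vertical step
at `i = m` from row `1` to row `2` in column `m`. [cite: MadrasSlade1993, Theorem 8.2.1 (8.2.13), p. 269 (statement shape; lane construction)] -/
theorem ushape_step {m i : ℕ} (hi : i + 1 < 2 * m + 2) :
    (((ucol m (i + 1) = ucol m i + 1 ∨ ucol m i = ucol m (i + 1) + 1) ∧ urow m (i + 1) = urow m i) ∨
      (ucol m (i + 1) = ucol m i ∧ ucol m i = m ∧ urow m i = 1 ∧ urow m (i + 1) = 2)) := by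
  unfold ucol urow; split_ifs <;> omega

/-- The shape is injective. [cite: MadrasSlade1993, Theorem 8.2.1 (8.2.13), p. 269 (statement shape; lane construction)] -/
theorem ushape_inj {m i i' : ℕ} (hi : i < 2 * m + 2) (hi' : i' < 2 * m + 2) (hc : ucol m i = ucol m i')
    (hr : urow m i = urow m i') : i = i' := by
  unfold ucol at hc; unfold urow at hr; split_ifs at hc hr <;> omega

/-- The U-turn of width `m` based at column `x`, inserted rows `s+1, s+2`: `2m + 2` points from `(x, s+1)` out to
`(x+m, s+1)`, up to `(x+m, s+2)` and back to `(x, s+2)`. [cite: MadrasSlade1993, Theorem 8.2.1 (8.2.13), p. 269 (statement shape; lane construction)] -/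
def uturn (x s : ℤ) (m : ℕ) : List (Site 2) :=
  (List.range (2 * m + 2)).map fun i => mk (x + ucol m i) (s + urow m i)

/-- A U-turn has `2m + 2` points. [cite: MadrasSlade1993, Theorem 8.2.1 (8.2.13), p. 269 (statement shape; lane construction)] -/
theorem length_uturn (x s : ℤ) (m : ℕ) : (uturn x s m).length = 2 * m + 2 := by
  simp [uturn]

/-- A U-turn is non-empty. [cite: MadrasSlade1993, Theorem 8.2.1 (8.2.13), p. 269 (statement shape; lane construction)] -/
theorem uturn_ne_nil (x s : ℤ) (m : ℕ) : uturn x s m ≠ [] := by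
  rw [← List.length_pos_iff_ne_nil, length_uturn]; omega

/-- Membership in a U-turn. [cite: MadrasSlade1993, Theorem 8.2.1 (8.2.13), p. 269 (statement shape; lane construction)] -/
theorem mem_uturn {x s : ℤ} {m : ℕ} {p : Site 2} :
    p ∈ uturn x s m ↔ ∃ i < 2 * m + 2, mk (x + ucol m i) (s + urow m i) = p := by
  simp only [uturn, List.mem_map, List.mem_range]

/-- Where the points of a U-turn live: columns `x … x+m`, rows `s+1, s+2`. [cite: MadrasSlade1993, Theorem 8.2.1 (8.2.13), p. 269 (statement shape; lane construction)] -/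
theorem mem_uturn_bounds {x s : ℤ} {m : ℕ} {p : Site 2} (hp : p ∈ uturn x s m) :
    x ≤ p 0 ∧ p 0 ≤ x + m ∧ s + 1 ≤ p 1 ∧ p 1 ≤ s + 2 := by
  obtain ⟨i, hi, rfl⟩ := mem_uturn.1 hp
  have h1 := ushape_range hi
  simp only [StripInsertion.mk_zero, StripInsertion.mk_one]
  omega

/-- The two far points `(x+m, s+1)`, `(x+m, s+2)` belong to the U-turn. [cite: MadrasSlade1993, Theorem 8.2.1 (8.2.13), p. 269 (statement shape; lane construction)] -/
theorem far_mem_uturn (x s : ℤ) (m : ℕ) {j : ℕ} (hj1 : 1 ≤ j) (hj2 : j ≤ 2) : mk (x + m) (s + j) ∈ uturn x s m := by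
  rcases (show j = 1 ∨ j = 2 by omega) with rfl | rfl
  · refine mem_uturn.2 ⟨m, by omega, ?_⟩
    simp [ucol, urow]
  · refine mem_uturn.2 ⟨m + 1, by omega, ?_⟩
    have h1 : ucol m (m + 1) = m := by unfold ucol; split_ifs <;> omega
    have h2 : urow m (m + 1) = 2 := by unfold urow; split_ifs <;> omega
    rw [h1, h2]

/-- A U-turn is duplicate-free. [cite: MadrasSlade1993, Theorem 8.2.1 (8.2.13), p. 269 (statement shape; lane construction)] -/
theorem nodup_uturn (x s : ℤ) (m : ℕ) : (uturn x s m).Nodup := by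
  refine List.Nodup.map_on (fun i hi i' hi' h => ?_) List.nodup_range
  rw [List.mem_range] at hi hi'
  obtain ⟨hc, hr⟩ := mk_inj.1 h
  exact ushape_inj hi hi' (by omega) (by omega)

/-- The head of `(range (m+1)).map f`. [cite: MadrasSlade1993, Theorem 8.2.1 (8.2.13), p. 269 (statement shape; lane construction)] -/
private theorem head?_map_range_succ' {α : Type*} (f : ℕ → α) (m : ℕ) :
    ((List.range (m + 1)).map f).head? = some (f 0) := by
  rw [List.range_succ_eq_map]; rfl

/-- The last element of `(range (m+1)).map f`. [cite: MadrasSlade1993, Theorem 8.2.1 (8.2.13), p. 269 (statement shape; lane construction)] -/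
private theorem getLast?_map_range_succ' {α : Type*} (f : ℕ → α) (m : ℕ) :
    ((List.range (m + 1)).map f).getLast? = some (f m) := by
  rw [List.range_succ, List.map_append, List.map_singleton, List.getLast?_append,
    List.getLast?_singleton, Option.some_or]

/-- **A U-turn is a brick-wall chain** when `x + m + s` is odd (the parity of the vertical bond `(x+m, s+1)–(x+m, s+2)`).
[cite: MadrasSlade1993, Theorem 8.2.1 (8.2.13), p. 269 (statement shape; lane construction)] -/
theorem isChain_uturn {x s : ℤ} {m : ℕ} (hpar : (x + m + s + 1) % 2 = 0) :
    (uturn x s m).IsChain brickWallGraph.Adj := by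
  refine isChain_map_range _ _ fun i hi => ?_
  rw [adj_mk_iff]
  have := ushape_step hi
  omega

/-- The reversed U-turn is a brick-wall chain. [cite: MadrasSlade1993, Theorem 8.2.1 (8.2.13), p. 269 (statement shape; lane construction)] -/
theorem isChain_reverse_uturn {x s : ℤ} {m : ℕ} (hpar : (x + m + s + 1) % 2 = 0) :
    (uturn x s m).reverse.IsChain brickWallGraph.Adj := by
  rw [List.isChain_reverse]
  exact (isChain_uturn hpar).imp fun a b h => h.symm

/-- The first point of a U-turn is `(x, s+1)`. [cite: MadrasSlade1993, Theorem 8.2.1 (8.2.13), p. 269 (statement shape; lane construction)] -/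
theorem head?_uturn (x s : ℤ) (m : ℕ) : (uturn x s m).head? = some (mk x (s + 1)) := by
  rw [uturn, show 2 * m + 2 = (2 * m + 1) + 1 by ring, head?_map_range_succ']
  simp [ucol, urow]

/-- The last point of a U-turn is `(x, s+2)`. [cite: MadrasSlade1993, Theorem 8.2.1 (8.2.13), p. 269 (statement shape; lane construction)] -/
theorem getLast?_uturn (x s : ℤ) (m : ℕ) : (uturn x s m).getLast? = some (mk x (s + 2)) := by
  rw [uturn, show 2 * m + 2 = (2 * m + 1) + 1 by ring, getLast?_map_range_succ']
  have h1 : ucol m (2 * m + 1) = 0 := by unfold ucol; split_ifs <;> omega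
  have h2 : urow m (2 * m + 1) = 2 := by unfold urow; split_ifs <;> omega
  rw [h1, h2]; simp

/-- The first point of the reversed U-turn is `(x, s+2)`. [cite: MadrasSlade1993, Theorem 8.2.1 (8.2.13), p. 269 (statement shape; lane construction)] -/
theorem head?_reverse_uturn (x s : ℤ) (m : ℕ) : (uturn x s m).reverse.head? = some (mk x (s + 2)) := by
  rw [List.head?_reverse, getLast?_uturn]

/-- The last point of the reversed U-turn is `(x, s+1)`. [cite: MadrasSlade1993, Theorem 8.2.1 (8.2.13), p. 269 (statement shape; lane construction)] -/
theorem getLast?_reverse_uturn (x s : ℤ) (m : ℕ) : (uturn x s m).reverse.getLast? = some (mk x (s + 1)) := by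
  rw [List.getLast?_reverse, head?_uturn]


/-! ### Crossing steps, cuts, rightmost strands (placed walk `ω`, `n` steps) -/

variable (ω : ℕ → Site 2) (n : ℕ)

/-- Step `t` of `ω` crosses the cut between the rows `c` and `c + 1`. [cite: MadrasSlade1993, Theorem 8.2.1 (8.2.13), p. 269 (statement shape; lane construction)] -/
def Crosses (t : ℕ) (c : ℤ) : Prop :=
  (ω t 1 = c ∧ ω (t + 1) 1 = c + 1) ∨ (ω t 1 = c + 1 ∧ ω (t + 1) 1 = c)

/-- `Crosses` is decidable. [cite: MadrasSlade1993, Theorem 8.2.1 (8.2.13), p. 269 (statement shape; lane construction)] -/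
instance (t : ℕ) (c : ℤ) : Decidable (Crosses ω t c) := by
  unfold Crosses; infer_instance

/-- The cut crossed by a vertical step `t`. [cite: MadrasSlade1993, Theorem 8.2.1 (8.2.13), p. 269 (statement shape; lane construction)] -/
def cutOf (t : ℕ) : ℤ := min (ω t 1) (ω (t + 1) 1)

/-- The times `< n` at which `ω` crosses the cut `c`. [cite: MadrasSlade1993, Theorem 8.2.1 (8.2.13), p. 269 (statement shape; lane construction)] -/
def crossTimes (c : ℤ) : Finset ℕ := (Finset.range n).filter fun t => Crosses ω t c

/-- The cuts crossed by the first `n` steps of `ω` (for the placed walk `t ↦ a + υ t` this is `HexBW.slabCuts a υ n`,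
definitionally). [cite: MadrasSlade1993, Theorem 8.2.1 (8.2.13), p. 269 (statement shape; lane construction)] -/
def cutsP : Finset ℤ :=
  ((Finset.range n).filter fun t => ω t 1 ≠ ω (t + 1) 1).image (cutOf ω)

/-- Step `t` is a crossing of `c` of maximal column (the RIGHTMOST strand of the cut). [cite: MadrasSlade1993, Theorem 8.2.1 (8.2.13), p. 269 (statement shape; lane construction)] -/
def IsRight (c : ℤ) (t : ℕ) : Prop := ∀ t' ∈ crossTimes ω n c, ω t' 0 ≤ ω t 0

/-- `IsRight` is decidable. [cite: MadrasSlade1993, Theorem 8.2.1 (8.2.13), p. 269 (statement shape; lane construction)] -/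
instance (c : ℤ) (t : ℕ) : Decidable (IsRight ω n c t) := by
  unfold IsRight; infer_instance

variable {ω n}

/-- Membership in `crossTimes`. [cite: MadrasSlade1993, Theorem 8.2.1 (8.2.13), p. 269 (statement shape; lane construction)] -/
theorem mem_crossTimes {c : ℤ} {t : ℕ} : t ∈ crossTimes ω n c ↔ t < n ∧ Crosses ω t c := by
  simp [crossTimes]

/-- A crossing step changes row. [cite: MadrasSlade1993, Theorem 8.2.1 (8.2.13), p. 269 (statement shape; lane construction)] -/
theorem Crosses.ne {t : ℕ} {c : ℤ} (h : Crosses ω t c) : ω t 1 ≠ ω (t + 1) 1 := by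
  rcases h with ⟨h1, h2⟩ | ⟨h1, h2⟩ <;> omega

/-- A crossing step of `c` has cut `c`. [cite: MadrasSlade1993, Theorem 8.2.1 (8.2.13), p. 269 (statement shape; lane construction)] -/
theorem Crosses.cutOf_eq {t : ℕ} {c : ℤ} (h : Crosses ω t c) : cutOf ω t = c := by
  unfold cutOf
  rcases h with ⟨h1, h2⟩ | ⟨h1, h2⟩ <;> rw [h1, h2] <;> simp

/-- A brick-wall step with different rows is a crossing of its cut, at constant column, with the bond parity
`column + cut` even. [cite: MadrasSlade1993, Theorem 8.2.1 (8.2.13), p. 269 (statement shape; lane construction)] -/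
theorem crosses_cutOf_of_ne {t : ℕ} (hadj : brickWallGraph.Adj (ω t) (ω (t + 1)))
    (hne : ω t 1 ≠ ω (t + 1) 1) :
    Crosses ω t (cutOf ω t) ∧ ω t 0 = ω (t + 1) 0 ∧ (ω t 0 + cutOf ω t) % 2 = 0 := by
  rw [brickWallGraph_adj_coord] at hadj
  rcases hadj with ⟨_, h1⟩ | ⟨h0, ⟨h1, hp⟩ | ⟨h1, hp⟩⟩
  · exact absurd h1.symm hne
  · have hc : cutOf ω t = ω t 1 := by simp [cutOf, h1]
    refine ⟨Or.inl ⟨hc.symm ▸ rfl, by rw [hc, h1]⟩, h0.symm, by rw [hc]; exact hp⟩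
  · have hc : cutOf ω t = ω (t + 1) 1 := by simp [cutOf, h1]
    refine ⟨Or.inr ⟨by rw [hc, h1], hc.symm ▸ rfl⟩, h0.symm, by rw [hc, ← h0]; exact hp⟩

/-- Membership in `cutsP`. [cite: MadrasSlade1993, Theorem 8.2.1 (8.2.13), p. 269 (statement shape; lane construction)] -/
theorem mem_cutsP {c : ℤ} : c ∈ cutsP ω n ↔ ∃ t < n, ω t 1 ≠ ω (t + 1) 1 ∧ cutOf ω t = c := by
  simp [cutsP, and_assoc]

/-- A cut of a brick-wall walk has a crossing time. [cite: MadrasSlade1993, Theorem 8.2.1 (8.2.13), p. 269 (statement shape; lane construction)] -/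
theorem crossTimes_nonempty (hadj : ∀ t < n, brickWallGraph.Adj (ω t) (ω (t + 1))) {c : ℤ}
    (hc : c ∈ cutsP ω n) : (crossTimes ω n c).Nonempty := by
  obtain ⟨t, ht, hne, rfl⟩ := mem_cutsP.1 hc
  exact ⟨t, mem_crossTimes.2 ⟨ht, (crosses_cutOf_of_ne (hadj t ht) hne).1⟩⟩

/-- Every cut of a brick-wall walk has a rightmost crossing. [cite: MadrasSlade1993, Theorem 8.2.1 (8.2.13), p. 269 (statement shape; lane construction)] -/
theorem exists_isRight (hadj : ∀ t < n, brickWallGraph.Adj (ω t) (ω (t + 1))) {c : ℤ}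
    (hc : c ∈ cutsP ω n) : ∃ t ∈ crossTimes ω n c, IsRight ω n c t :=
  Finset.exists_max_image _ (fun t => ω t 0) (crossTimes_nonempty hadj hc)

/-- Two crossings of the same cut at the same column are the same step (self-avoidance). [cite: MadrasSlade1993, Theorem 8.2.1 (8.2.13), p. 269 (statement shape; lane construction)] -/
theorem crossTimes_col_inj (hinj : Set.InjOn ω {i | i ≤ n})
    (hcol : ∀ t < n, ω t 1 ≠ ω (t + 1) 1 → ω t 0 = ω (t + 1) 0) {c : ℤ} {t t' : ℕ}
    (ht : t ∈ crossTimes ω n c) (ht' : t' ∈ crossTimes ω n c) (h : ω t 0 = ω t' 0) : t = t' := by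
  obtain ⟨htn, htc⟩ := mem_crossTimes.1 ht
  obtain ⟨htn', htc'⟩ := mem_crossTimes.1 ht'
  have hr := hcol t htn htc.ne
  have hr' := hcol t' htn' htc'.ne
  rcases htc with ⟨a1, a2⟩ | ⟨a1, a2⟩ <;> rcases htc' with ⟨b1, b2⟩ | ⟨b1, b2⟩
  · have : ω t = ω t' := by rw [eq_mk (ω t), eq_mk (ω t'), a1, b1, h]
    exact hinj (by show t ≤ n; omega) (by show t' ≤ n; omega) this
  · have e1 : ω t = ω (t' + 1) := by rw [eq_mk (ω t), eq_mk (ω (t' + 1)), a1, b2, h, hr']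
    have e2 : ω (t + 1) = ω t' := by rw [eq_mk (ω (t + 1)), eq_mk (ω t'), a2, b1, ← hr, h]
    have := hinj (by show t ≤ n; omega) (by show t' + 1 ≤ n; omega) e1
    have := hinj (by show t + 1 ≤ n; omega) (by show t' ≤ n; omega) e2
    omega
  · have e1 : ω t = ω (t' + 1) := by rw [eq_mk (ω t), eq_mk (ω (t' + 1)), a1, b2, h, hr']
    have e2 : ω (t + 1) = ω t' := by rw [eq_mk (ω (t + 1)), eq_mk (ω t'), a2, b1, ← hr, h]
    have := hinj (by show t ≤ n; omega) (by show t' + 1 ≤ n; omega) e1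
    have := hinj (by show t + 1 ≤ n; omega) (by show t' ≤ n; omega) e2
    omega
  · have : ω t = ω t' := by rw [eq_mk (ω t), eq_mk (ω t'), a1, b1, h]
    exact hinj (by show t ≤ n; omega) (by show t' ≤ n; omega) this

/-! ### The blocks and the image list -/

/-- The width of the U-turn of a crossing step `t` in the slab of `H + 1` columns: all the way to the new column `H + 1`
for the rightmost strand of its cut, `1` otherwise. [cite: MadrasSlade1993, Theorem 8.2.1 (8.2.13), p. 269 (statement shape; lane construction)] -/
def width (H : ℕ) (ω : ℕ → Site 2) (n t : ℕ) : ℕ :=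
  if IsRight ω n (cutOf ω t) t then (((H : ℤ) + 1 - ω t 0).toNat) else 1

/-- The block of image points replacing the step `t` (not including the next anchor): the anchor `σ(ω t)` alone; or,
for a crossing of a cut `c ∈ R`, the anchor followed by the U-turn of the strand (traversed forwards for an upward
step, backwards for a downward one). [cite: MadrasSlade1993, Theorem 8.2.1 (8.2.13), p. 269 (statement shape; lane construction)] -/
def block (H : ℕ) (y₀ : ℤ) (R : Finset ℤ) (ω : ℕ → Site 2) (n t : ℕ) : List (Site 2) :=
  if ω t 1 ≠ ω (t + 1) 1 ∧ cutOf ω t ∈ R then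
    vmap y₀ R (ω t) ::
      (if ω t 1 < ω (t + 1) 1 then uturn (ω t 0) (rowMap y₀ R (cutOf ω t)) (width H ω n t)
        else (uturn (ω t 0) (rowMap y₀ R (cutOf ω t)) (width H ω n t)).reverse)
  else [vmap y₀ R (ω t)]

/-- The image list `Ψ(ω, R)`: the blocks of the steps `0, …, n-1`, then the last anchor. [cite: MadrasSlade1993, Theorem 8.2.1 (8.2.13), p. 269 (statement shape; lane construction)] -/
def imageList (H : ℕ) (y₀ : ℤ) (R : Finset ℤ) (ω : ℕ → Site 2) (n : ℕ) : List (Site 2) :=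
  (List.range n).flatMap (block H y₀ R ω n) ++ [vmap y₀ R (ω n)]

/-- The extra length of the block of step `t` (for a crossing step of a cut in `R`): `2·width + 2`.
[cite: MadrasSlade1993, Theorem 8.2.1 (8.2.13), p. 269 (statement shape; lane construction)] -/
def extra (H : ℕ) (ω : ℕ → Site 2) (n : ℕ) (t : ℕ) : ℕ := 2 * width H ω n t + 2

/-- The cost of the cut `c`: the total extra length of the blocks of its crossings. [cite: MadrasSlade1993, Theorem 8.2.1 (8.2.13), p. 269 (statement shape; lane construction)] -/
def cost (H : ℕ) (ω : ℕ → Site 2) (n : ℕ) (c : ℤ) : ℕ :=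
  ∑ t ∈ crossTimes ω n c, extra H ω n t

/-- Blocks are non-empty. [cite: MadrasSlade1993, Theorem 8.2.1 (8.2.13), p. 269 (statement shape; lane construction)] -/
theorem block_ne_nil (H : ℕ) (y₀ : ℤ) (R : Finset ℤ) (ω : ℕ → Site 2) (n t : ℕ) :
    block H y₀ R ω n t ≠ [] := by
  unfold block; split_ifs <;> simp

/-- Every block starts with the anchor `σ(ω t)`. [cite: MadrasSlade1993, Theorem 8.2.1 (8.2.13), p. 269 (statement shape; lane construction)] -/
theorem head?_block (H : ℕ) (y₀ : ℤ) (R : Finset ℤ) (ω : ℕ → Site 2) (n t : ℕ) :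
    (block H y₀ R ω n t).head? = some (vmap y₀ R (ω t)) := by
  unfold block; split_ifs <;> simp

/-! ### Slab walks -/

/-- The standing hypotheses: `ω` is an `n`-step self-avoiding brick-wall walk in the slab `0 ≤ column ≤ H`.
[cite: MadrasSlade1993, Theorem 8.2.1 (8.2.13), p. 269 (statement shape; lane construction)] -/
structure SlabWalk (H : ℕ) (ω : ℕ → Site 2) (n : ℕ) : Prop where
  adj : ∀ t < n, brickWallGraph.Adj (ω t) (ω (t + 1))
  inj : Set.InjOn ω {i | i ≤ n}
  col_nonneg : ∀ t ≤ n, 0 ≤ ω t 0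
  col_le : ∀ t ≤ n, ω t 0 ≤ (H : ℤ)

variable {H : ℕ} {y₀ : ℤ} {R : Finset ℤ}

/-- A vertical step of a slab walk keeps the column. [cite: MadrasSlade1993, Theorem 8.2.1 (8.2.13), p. 269 (statement shape; lane construction)] -/
theorem SlabWalk.col_eq (hW : SlabWalk H ω n) {t : ℕ} (ht : t < n) (hne : ω t 1 ≠ ω (t + 1) 1) :
    ω t 0 = ω (t + 1) 0 :=
  (crosses_cutOf_of_ne (hW.adj t ht) hne).2.1

/-- Vertical steps of a slab walk keep the column (all steps). [cite: MadrasSlade1993, Theorem 8.2.1 (8.2.13), p. 269 (statement shape; lane construction)] -/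
theorem SlabWalk.cols (hW : SlabWalk H ω n) : ∀ t < n, ω t 1 ≠ ω (t + 1) 1 → ω t 0 = ω (t + 1) 0 :=
  fun _ ht hne => hW.col_eq ht hne

/-- The geometry of a crossing step of a cut `c = cutOf ω t ∈ R`: for an upward step `σ(row ω t) = σ c` and the next
anchor row is `σ c + 3`; for a downward step `σ(row ω t) = σ c + 3` and the next anchor row is `σ c`.
[cite: MadrasSlade1993, Theorem 8.2.1 (8.2.13), p. 269 (statement shape; lane construction)] -/
theorem crossing_geometry (hW : SlabWalk H ω n) {t : ℕ} (ht : t < n) (hne : ω t 1 ≠ ω (t + 1) 1)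
    (hR : cutOf ω t ∈ R) :
    (ω t 1 < ω (t + 1) 1 ∧ rowMap y₀ R (ω t 1) = rowMap y₀ R (cutOf ω t) ∧
        rowMap y₀ R (ω (t + 1) 1) = rowMap y₀ R (cutOf ω t) + 3) ∨
      (¬ ω t 1 < ω (t + 1) 1 ∧ rowMap y₀ R (ω t 1) = rowMap y₀ R (cutOf ω t) + 3 ∧
        rowMap y₀ R (ω (t + 1) 1) = rowMap y₀ R (cutOf ω t)) := by
  have hc := (crosses_cutOf_of_ne (hW.adj t ht) hne).1
  have h3 := rowMap_succ_of_mem (y₀ := y₀) hR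
  rcases hc with ⟨h1, h2⟩ | ⟨h1, h2⟩
  · left
    rw [h2, h1]
    exact ⟨by omega, rfl, h3⟩
  · right
    rw [h1, h2, h3]
    exact ⟨by omega, rfl, rfl⟩

/-- The width of a U-turn fits in the wider slab: `column + width ≤ H + 1`, and `= H + 1` for the rightmost strand.
[cite: MadrasSlade1993, Theorem 8.2.1 (8.2.13), p. 269 (statement shape; lane construction)] -/
theorem col_add_width (hW : SlabWalk H ω n) {t : ℕ} (ht : t ≤ n) :
    ω t 0 + (width H ω n t : ℤ) ≤ (H : ℤ) + 1 ∧ 1 ≤ width H ω n t ∧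
      (IsRight ω n (cutOf ω t) t → ω t 0 + (width H ω n t : ℤ) = (H : ℤ) + 1) ∧
      (¬ IsRight ω n (cutOf ω t) t → width H ω n t = 1) := by
  have h0 := hW.col_nonneg t ht
  have hH := hW.col_le t ht
  unfold width
  split_ifs with h
  · have e : ((((H : ℤ) + 1 - ω t 0).toNat : ℕ) : ℤ) = (H : ℤ) + 1 - ω t 0 := Int.toNat_of_nonneg (by omega)
    refine ⟨by omega, ?_, fun _ => by omega, fun h' => absurd h h'⟩
    have : (1 : ℤ) ≤ ((((H : ℤ) + 1 - ω t 0).toNat : ℕ) : ℤ) := by omega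
    exact_mod_cast this
  · exact ⟨by push_cast; omega, le_rfl, fun h' => absurd h' h, fun _ => rfl⟩

/-- Where the points of a block live: the anchor `σ(ω t)`, or an inserted point of the cut `c = cutOf ω t ∈ R` in one of
the two inserted rows `σ c + 1, σ c + 2`, in the columns `col(ω t) … col(ω t) + width`.
[cite: MadrasSlade1993, Theorem 8.2.1 (8.2.13), p. 269 (statement shape; lane construction)] -/
theorem mem_block {t : ℕ} {z : Site 2} (hz : z ∈ block H y₀ R ω n t) :
    z = vmap y₀ R (ω t) ∨
    (ω t 1 ≠ ω (t + 1) 1 ∧ cutOf ω t ∈ R ∧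
      (rowMap y₀ R (cutOf ω t) + 1 ≤ z 1 ∧ z 1 ≤ rowMap y₀ R (cutOf ω t) + 2) ∧
      ω t 0 ≤ z 0 ∧ z 0 ≤ ω t 0 + (width H ω n t : ℤ)) := by
  unfold block at hz
  split_ifs at hz with h1 h2
  · rcases List.mem_cons.1 hz with rfl | hz
    · exact Or.inl rfl
    · right
      have hb := mem_uturn_bounds hz
      exact ⟨h1.1, h1.2, ⟨hb.2.2.1, hb.2.2.2⟩, hb.1, hb.2.1⟩
  · rcases List.mem_cons.1 hz with rfl | hz
    · exact Or.inl rfl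
    · right
      rw [List.mem_reverse] at hz
      have hb := mem_uturn_bounds hz
      exact ⟨h1.1, h1.2, ⟨hb.2.2.1, hb.2.2.2⟩, hb.1, hb.2.1⟩
  · simp only [List.mem_singleton] at hz
    exact Or.inl hz

/-- All block points lie in the columns `0 … H+1`. [cite: MadrasSlade1993, Theorem 8.2.1 (8.2.13), p. 269 (statement shape; lane construction)] -/
theorem col_mem_block (hW : SlabWalk H ω n) {t : ℕ} (ht : t < n) {z : Site 2}
    (hz : z ∈ block H y₀ R ω n t) : 0 ≤ z 0 ∧ z 0 ≤ (H : ℤ) + 1 := by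
  have hw := (col_add_width hW ht.le).1
  rcases mem_block hz with rfl | ⟨-, -, -, h1, h2⟩
  · exact ⟨by simpa using hW.col_nonneg t ht.le, by simp; have := hW.col_le t ht.le; omega⟩
  · exact ⟨(hW.col_nonneg t ht.le).trans h1, h2.trans hw⟩

/-- No anchor row is an inserted row (interval form). [cite: MadrasSlade1993, Theorem 8.2.1 (8.2.13), p. 269 (statement shape; lane construction)] -/
theorem rowMap_not_ins {c : ℤ} (hc : c ∈ R) (y : ℤ) :
    ¬ (rowMap y₀ R c + 1 ≤ rowMap y₀ R y ∧ rowMap y₀ R y ≤ rowMap y₀ R c + 2) := by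
  rintro ⟨h1, h2⟩
  rcases le_or_gt y c with hyc | hyc
  · have := (rowMap_le_iff y₀ R).2 hyc; omega
  · have h3 : c + 1 ≤ y := hyc
    have := (rowMap_le_iff y₀ R).2 h3
    rw [rowMap_succ_of_mem hc] at this; omega

/-- Inserted rows of a smaller cut lie below those of a larger cut. [cite: MadrasSlade1993, Theorem 8.2.1 (8.2.13), p. 269 (statement shape; lane construction)] -/
theorem ins_lt_ins {c c' : ℤ} (hc : c ∈ R) (hcc : c < c') : rowMap y₀ R c + 2 < rowMap y₀ R c' + 1 := by
  have h1 : c + 1 ≤ c' := hcc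
  have := (rowMap_le_iff y₀ R).2 h1
  rw [rowMap_succ_of_mem hc] at this; omega

/-- Each block is duplicate-free. [cite: MadrasSlade1993, Theorem 8.2.1 (8.2.13), p. 269 (statement shape; lane construction)] -/
theorem nodup_block (y₀ : ℤ) (R : Finset ℤ) (ω : ℕ → Site 2) (n t : ℕ) : (block H y₀ R ω n t).Nodup := by
  unfold block
  split_ifs with h1 h2
  · refine List.nodup_cons.2 ⟨fun hmem => ?_, nodup_uturn _ _ _⟩
    have hb := mem_uturn_bounds hmem
    simp only [vmap_one] at hb
    exact rowMap_not_ins h1.2 (ω t 1) ⟨hb.2.2.1, hb.2.2.2⟩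
  · refine List.nodup_cons.2 ⟨fun hmem => ?_, List.nodup_reverse.2 (nodup_uturn _ _ _)⟩
    rw [List.mem_reverse] at hmem
    have hb := mem_uturn_bounds hmem
    simp only [vmap_one] at hb
    exact rowMap_not_ins h1.2 (ω t 1) ⟨hb.2.2.1, hb.2.2.2⟩
  · exact List.nodup_singleton _

/-- Two crossings of the same cut `c` are at columns of the parity of `c`, hence at distance `≥ 2` when distinct.
[cite: MadrasSlade1993, Theorem 8.2.1 (8.2.13), p. 269 (statement shape; lane construction)] -/
theorem col_sep (hW : SlabWalk H ω n) {t t' : ℕ} (ht : t < n) (ht' : t' < n) (htt : t ≠ t')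
    (hne : ω t 1 ≠ ω (t + 1) 1) (hne' : ω t' 1 ≠ ω (t' + 1) 1) (hcc : cutOf ω t = cutOf ω t') :
    ω t 0 + 2 ≤ ω t' 0 ∨ ω t' 0 + 2 ≤ ω t 0 := by
  have h1 := crosses_cutOf_of_ne (hW.adj t ht) hne
  have h2 := crosses_cutOf_of_ne (hW.adj t' ht') hne'
  have hx : t ∈ crossTimes ω n (cutOf ω t) := mem_crossTimes.2 ⟨ht, h1.1⟩
  have hx' : t' ∈ crossTimes ω n (cutOf ω t) := by rw [hcc]; exact mem_crossTimes.2 ⟨ht', h2.1⟩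
  have hxx : ω t 0 ≠ ω t' 0 := fun h => htt (crossTimes_col_inj hW.inj hW.cols hx hx' h)
  have p1 := h1.2.2
  have p2 := h2.2.2
  rw [hcc] at p1
  omega

/-- Distinct blocks are disjoint. [cite: MadrasSlade1993, Theorem 8.2.1 (8.2.13), p. 269 (statement shape; lane construction)] -/
theorem disjoint_block (hW : SlabWalk H ω n) {t t' : ℕ} (ht : t < n) (ht' : t' < n) (htt : t ≠ t') :
    List.Disjoint (block H y₀ R ω n t) (block H y₀ R ω n t') := by
  intro z hz hz'
  rcases mem_block hz with rfl | ⟨hne, hR, hrow, hc1, hc2⟩ <;>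
    rcases mem_block hz' with h | ⟨hne', hR', hrow', hc1', hc2'⟩
  · exact htt (hW.inj (by show t ≤ n; omega) (by show t' ≤ n; omega) (vmap_injective y₀ R h))
  · exact rowMap_not_ins hR' (ω t 1) (by simpa using hrow')
  · rw [h] at hrow
    exact rowMap_not_ins hR (ω t' 1) (by simpa using hrow)
  · -- two inserted points
    by_cases hcc : cutOf ω t = cutOf ω t'
    · -- same cut: compare columns
      have hsep := col_sep hW ht ht' htt hne hne' hcc
      have hw := col_add_width hW ht.le
      have hw' := col_add_width hW ht'.le
      have hx : t ∈ crossTimes ω n (cutOf ω t) :=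
        mem_crossTimes.2 ⟨ht, (crosses_cutOf_of_ne (hW.adj t ht) hne).1⟩
      have hx' : t' ∈ crossTimes ω n (cutOf ω t') :=
        mem_crossTimes.2 ⟨ht', (crosses_cutOf_of_ne (hW.adj t' ht') hne').1⟩
      by_cases hT : IsRight ω n (cutOf ω t) t
      · have h1 := hT t' (by rw [hcc]; exact hx')
        by_cases hT' : IsRight ω n (cutOf ω t') t'
        · have h2 := hT' t (by rw [← hcc]; exact hx)
          omega
        · have := hw'.2.2.2 hT'
          rw [this] at hc2'
          push_cast at hc2'
          omega
      · have e1 := hw.2.2.2 hT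
        rw [e1] at hc2
        push_cast at hc2
        by_cases hT' : IsRight ω n (cutOf ω t') t'
        · have h2 := hT' t (by rw [← hcc]; exact hx)
          omega
        · have := hw'.2.2.2 hT'
          rw [this] at hc2'
          push_cast at hc2'
          omega
    · rcases lt_or_gt_of_ne hcc with hlt | hlt
      · have := ins_lt_ins (y₀ := y₀) hR hlt; omega
      · have := ins_lt_ins (y₀ := y₀) hR' hlt; omega

/-- The final anchor is in no block. [cite: MadrasSlade1993, Theorem 8.2.1 (8.2.13), p. 269 (statement shape; lane construction)] -/
theorem last_not_mem_block (hW : SlabWalk H ω n) {t : ℕ} (ht : t < n) :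
    vmap y₀ R (ω n) ∉ block H y₀ R ω n t := by
  intro hz
  rcases mem_block hz with h | ⟨-, hR, hrow, -⟩
  · have := hW.inj (by show n ≤ n; omega) (by show t ≤ n; omega) (vmap_injective y₀ R h)
    omega
  · exact rowMap_not_ins hR (ω n 1) (by simpa using hrow)

/-- **The image list has no repeated point.** [cite: MadrasSlade1993, Theorem 8.2.1 (8.2.13), p. 269 (statement shape; lane construction)] -/
theorem nodup_imageList (hW : SlabWalk H ω n) (R : Finset ℤ) : (imageList H y₀ R ω n).Nodup := by
  rw [imageList, List.nodup_append]
  refine ⟨?_, List.nodup_singleton _, ?_⟩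
  · rw [List.nodup_flatMap]
    refine ⟨fun t _ => nodup_block y₀ R ω n t, ?_⟩
    exact List.pairwise_lt_range.imp_of_mem fun {t t'} ht ht' hlt =>
      disjoint_block hW (List.mem_range.1 ht) (List.mem_range.1 ht') hlt.ne
  · intro z hz z' hz' hzz
    rw [List.mem_singleton] at hz'
    subst hzz; subst hz'
    obtain ⟨t, ht, hzt⟩ := List.mem_flatMap.1 hz
    exact last_not_mem_block hW (List.mem_range.1 ht) hzt


/-! ### The image list is a brick-wall chain -/

/-- Parity at a crossing of an admissible cut: `col + width + σ c + 1` is even when `c + H` is even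
(`col + c` even by the bond, `σ c ≡ c`, and `col + width = H + 1` for the rightmost strand, `width = 1` otherwise).
[cite: MadrasSlade1993, Theorem 8.2.1 (8.2.13), p. 269 (statement shape; lane construction)] -/
theorem parity_of_admissible (hW : SlabWalk H ω n) {t : ℕ} (ht : t < n) (hne : ω t 1 ≠ ω (t + 1) 1)
    (hc : (cutOf ω t + (H : ℤ)) % 2 = 0) :
    (ω t 0 + (width H ω n t : ℤ) + rowMap y₀ R (cutOf ω t) + 1) % 2 = 0 := by
  obtain ⟨k, hk⟩ := rowMap_eq_add y₀ R (cutOf ω t)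
  have hp := (crosses_cutOf_of_ne (hW.adj t ht) hne).2.2
  have hw := col_add_width hW ht.le
  by_cases h : IsRight ω n (cutOf ω t) t
  · have e := hw.2.2.1 h
    omega
  · have e := hw.2.2.2 h
    rw [e]; push_cast
    omega

/-- Each block is a brick-wall chain (cuts of `R` admissible). [cite: MadrasSlade1993, Theorem 8.2.1 (8.2.13), p. 269 (statement shape; lane construction)] -/
theorem isChain_block (hW : SlabWalk H ω n) (hRad : ∀ c ∈ R, (c + (H : ℤ)) % 2 = 0) {t : ℕ} (ht : t < n) :
    (block H y₀ R ω n t).IsChain brickWallGraph.Adj := by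
  unfold block
  split_ifs with h1 h2
  · have hg := crossing_geometry (y₀ := y₀) hW ht h1.1 h1.2
    have hp := (crosses_cutOf_of_ne (hW.adj t ht) h1.1).2.2
    obtain ⟨k, hk⟩ := rowMap_eq_add y₀ R (cutOf ω t)
    rw [List.isChain_cons]
    refine ⟨fun y hy => ?_, isChain_uturn (parity_of_admissible hW ht h1.1 (hRad _ h1.2))⟩
    rw [head?_uturn, Option.mem_def, Option.some.injEq] at hy
    subst hy
    unfold vmap; rw [adj_mk_iff]; right
    refine ⟨rfl, Or.inl ⟨?_, ?_⟩⟩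
    · rcases hg with ⟨-, g, -⟩ | ⟨g, -, -⟩
      · rw [g]
      · exact absurd h2 g
    · rcases hg with ⟨-, g, -⟩ | ⟨g, -, -⟩
      · rw [g]; omega
      · exact absurd h2 g
  · have hg := crossing_geometry (y₀ := y₀) hW ht h1.1 h1.2
    have hp := (crosses_cutOf_of_ne (hW.adj t ht) h1.1).2.2
    obtain ⟨k, hk⟩ := rowMap_eq_add y₀ R (cutOf ω t)
    rw [List.isChain_cons]
    refine ⟨fun y hy => ?_, isChain_reverse_uturn (parity_of_admissible hW ht h1.1 (hRad _ h1.2))⟩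
    rw [head?_reverse_uturn, Option.mem_def, Option.some.injEq] at hy
    subst hy
    unfold vmap; rw [adj_mk_iff]; right
    refine ⟨rfl, Or.inr ⟨?_, ?_⟩⟩
    · rcases hg with ⟨g, -, -⟩ | ⟨-, g, -⟩
      · exact absurd g h2
      · rw [g]; ring
    · omega
  · exact List.isChain_singleton _

/-- The last point of the block of step `t` is adjacent to the next anchor. [cite: MadrasSlade1993, Theorem 8.2.1 (8.2.13), p. 269 (statement shape; lane construction)] -/
theorem getLast_block_adj (hW : SlabWalk H ω n) {t : ℕ} (ht : t < n) :
    ∀ z ∈ (block H y₀ R ω n t).getLast?, brickWallGraph.Adj z (vmap y₀ R (ω (t + 1))) := by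
  intro z hz
  unfold block at hz
  split_ifs at hz with h1 h2
  · have hg := crossing_geometry (y₀ := y₀) hW ht h1.1 h1.2
    have hp := (crosses_cutOf_of_ne (hW.adj t ht) h1.1).2.2
    have hcol := hW.col_eq ht h1.1
    obtain ⟨k, hk⟩ := rowMap_eq_add y₀ R (cutOf ω t)
    rw [List.getLast?_cons, getLast?_uturn] at hz
    simp only [Option.getD_some, Option.mem_def, Option.some.injEq] at hz
    subst hz
    unfold vmap
    rw [adj_mk_iff]; right
    refine ⟨hcol.symm, Or.inl ⟨?_, ?_⟩⟩
    · rcases hg with ⟨-, -, g⟩ | ⟨g, -, -⟩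
      · rw [g]; ring
      · exact absurd h2 g
    · omega
  · have hg := crossing_geometry (y₀ := y₀) hW ht h1.1 h1.2
    have hp := (crosses_cutOf_of_ne (hW.adj t ht) h1.1).2.2
    have hcol := hW.col_eq ht h1.1
    obtain ⟨k, hk⟩ := rowMap_eq_add y₀ R (cutOf ω t)
    rw [List.getLast?_cons, getLast?_reverse_uturn] at hz
    simp only [Option.getD_some, Option.mem_def, Option.some.injEq] at hz
    subst hz
    unfold vmap
    rw [adj_mk_iff]; right
    refine ⟨hcol.symm, Or.inr ⟨?_, ?_⟩⟩
    · rcases hg with ⟨g, -, -⟩ | ⟨-, -, g⟩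
      · exact absurd g h2
      · rw [g]
    · rcases hg with ⟨g, -, -⟩ | ⟨-, -, g⟩
      · exact absurd g h2
      · rw [← hcol, g]; omega
  · simp only [List.getLast?_singleton, Option.mem_def, Option.some.injEq] at hz
    subst hz
    refine adj_vmap_of_adj (hW.adj t ht) fun hne => ?_
    exact fun hR => h1 ⟨hne, hR⟩

/-- Gluing the blocks: the concatenation of the blocks `0 … m-1` (`m ≤ n`) is a chain whose last point is adjacent to
the anchor `σ(ω m)`. [cite: MadrasSlade1993, Theorem 8.2.1 (8.2.13), p. 269 (statement shape; lane construction)] -/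
theorem isChain_flatMap_blocks (hW : SlabWalk H ω n) (hRad : ∀ c ∈ R, (c + (H : ℤ)) % 2 = 0) :
    ∀ m ≤ n, ((List.range m).flatMap (block H y₀ R ω n)).IsChain brickWallGraph.Adj ∧
      ∀ z ∈ ((List.range m).flatMap (block H y₀ R ω n)).getLast?, brickWallGraph.Adj z (vmap y₀ R (ω m))
  | 0, _ => by simp
  | m + 1, hm => by
    obtain ⟨ih1, ih2⟩ := isChain_flatMap_blocks hW hRad m (by omega)
    rw [List.range_succ, List.flatMap_append, List.flatMap_singleton]
    refine ⟨List.IsChain.append ih1 (isChain_block hW hRad (by omega)) fun z hz y hy => ?_, ?_⟩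
    · rw [head?_block, Option.mem_def, Option.some.injEq] at hy
      subst hy
      exact ih2 z hz
    · intro z hz
      rw [List.getLast?_append] at hz
      obtain ⟨w, hw⟩ := List.getLast?_isSome.2 (block_ne_nil H y₀ R ω n m) |> Option.isSome_iff_exists.1
      rw [hw, Option.some_or, Option.mem_def, Option.some.injEq] at hz
      subst hz
      exact getLast_block_adj hW (by omega) w (by rw [hw]; rfl)

/-- **The image list is a brick-wall chain.** [cite: MadrasSlade1993, Theorem 8.2.1 (8.2.13), p. 269 (statement shape; lane construction)] -/
theorem isChain_imageList (hW : SlabWalk H ω n) (hRad : ∀ c ∈ R, (c + (H : ℤ)) % 2 = 0) :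
    (imageList H y₀ R ω n).IsChain brickWallGraph.Adj := by
  obtain ⟨h1, h2⟩ := isChain_flatMap_blocks (y₀ := y₀) hW hRad n le_rfl
  exact List.IsChain.append h1 (List.isChain_singleton _) fun z hz y hy => by
    rw [List.head?_cons, Option.mem_def, Option.some.injEq] at hy
    subst hy; exact h2 z hz

/-- The image list starts at the anchor `σ(ω 0)`. [cite: MadrasSlade1993, Theorem 8.2.1 (8.2.13), p. 269 (statement shape; lane construction)] -/
theorem head?_imageList (H : ℕ) (y₀ : ℤ) (R : Finset ℤ) (ω : ℕ → Site 2) (n : ℕ) :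
    (imageList H y₀ R ω n).head? = some (vmap y₀ R (ω 0)) := by
  unfold imageList
  cases n with
  | zero => simp
  | succ n =>
    rw [List.range_succ_eq_map, List.flatMap_cons, List.append_assoc, List.head?_append,
      head?_block, Option.some_or]

/-- All points of the image list lie in the columns `0 … H+1`. [cite: MadrasSlade1993, Theorem 8.2.1 (8.2.13), p. 269 (statement shape; lane construction)] -/
theorem col_mem_imageList (hW : SlabWalk H ω n) {z : Site 2} (hz : z ∈ imageList H y₀ R ω n) :
    0 ≤ z 0 ∧ z 0 ≤ (H : ℤ) + 1 := by
  rw [imageList, List.mem_append, List.mem_flatMap, List.mem_singleton] at hz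
  rcases hz with ⟨t, ht, hzt⟩ | rfl
  · exact col_mem_block hW (List.mem_range.1 ht) hzt
  · exact ⟨by simpa using hW.col_nonneg n le_rfl, by simp; have := hW.col_le n le_rfl; omega⟩

/-! ### The image walk `Ψ(ω, R)` -/

/-- `Ψ(ω,R)` as a vertex function from the origin (base row = the row of `ω 0`). [cite: MadrasSlade1993, Theorem 8.2.1 (8.2.13), p. 269 (statement shape; lane construction)] -/
def psi (H : ℕ) (R : Finset ℤ) (ω : ℕ → Site 2) (n : ℕ) : ℕ → Site 2 :=
  fun s => StripInsertion.ofList (imageList H (ω 0 1) R ω n) s - ω 0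

/-- The image list is non-empty. [cite: MadrasSlade1993, Theorem 8.2.1 (8.2.13), p. 269 (statement shape; lane construction)] -/
theorem imageList_ne_nil (H : ℕ) (y₀ : ℤ) (R : Finset ℤ) (ω : ℕ → Site 2) (n : ℕ) :
    imageList H y₀ R ω n ≠ [] := by
  simp [imageList]

/-- **`Ψ(ω,R)` is a self-avoiding walk** of length `|imageList| - 1` from the origin, whose translate by `ω 0` is a
brick-wall walk in the slab of `H + 2` columns. [cite: MadrasSlade1993, Theorem 8.2.1 (8.2.13), p. 269 (statement shape; lane construction)] -/
theorem psi_spec (hW : SlabWalk H ω n) (hRad : ∀ c ∈ R, (c + (H : ℤ)) % 2 = 0) :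
    psi H R ω n ∈ Zd.saws 2 ((imageList H (ω 0 1) R ω n).length - 1) ∧
      IsBW ((imageList H (ω 0 1) R ω n).length - 1) (fun i => ω 0 + psi H R ω n i) ∧
      ∀ m ≤ (imageList H (ω 0 1) R ω n).length - 1, InSlab (H + 1) (ω 0 + psi H R ω n m) := by
  have h := StripInsertion.ofList_sub_mem_saws (imageList_ne_nil H (ω 0 1) R ω n) (nodup_imageList hW R)
    (isChain_imageList hW hRad) (ω 0) (by rw [head?_imageList, vmap_eq_self_of_row R rfl])
  refine ⟨h.1, ?_, fun m _ => ?_⟩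
  · have e : (fun i => ω 0 + psi H R ω n i) = StripInsertion.ofList (imageList H (ω 0 1) R ω n) := by
      funext i; simp [psi]
    rw [e]; exact h.2
  · have e : ω 0 + psi H R ω n m = StripInsertion.ofList (imageList H (ω 0 1) R ω n) m := by simp [psi]
    rw [e]
    have := col_mem_imageList hW (StripInsertion.ofList_mem (imageList_ne_nil H (ω 0 1) R ω n) m)
    exact ⟨this.1, by push_cast; exact this.2⟩


/-! ### Length of the image and the cost of a cut -/

/-- The length of a block: `1 +` the extra length of a crossing of a cut of `R`. [cite: MadrasSlade1993, Theorem 8.2.1 (8.2.13), p. 269 (statement shape; lane construction)] -/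
theorem length_block (H : ℕ) (y₀ : ℤ) (R : Finset ℤ) (ω : ℕ → Site 2) (n t : ℕ) :
    (block H y₀ R ω n t).length =
      1 + if ω t 1 ≠ ω (t + 1) 1 ∧ cutOf ω t ∈ R then extra H ω n t else 0 := by
  unfold block extra
  split_ifs <;> simp [length_uturn] <;> omega

/-- The crossing times of `c` are the vertical steps whose cut is `c`. [cite: MadrasSlade1993, Theorem 8.2.1 (8.2.13), p. 269 (statement shape; lane construction)] -/
theorem crossTimes_eq_filter (hW : SlabWalk H ω n) (c : ℤ) :
    crossTimes ω n c = (Finset.range n).filter fun t => ω t 1 ≠ ω (t + 1) 1 ∧ cutOf ω t = c := by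
  ext t
  rw [mem_crossTimes, Finset.mem_filter, Finset.mem_range]
  constructor
  · rintro ⟨ht, hc⟩
    exact ⟨ht, hc.ne, hc.cutOf_eq⟩
  · rintro ⟨ht, hne, rfl⟩
    exact ⟨ht, (crosses_cutOf_of_ne (hW.adj t ht) hne).1⟩

/-- **Length of the image**: `|Ψ(ω,R)| = n + Σ_{c ∈ R} cost(c)` steps. [cite: MadrasSlade1993, Theorem 8.2.1 (8.2.13), p. 269 (statement shape; lane construction)] -/
theorem length_imageList (hW : SlabWalk H ω n) (R : Finset ℤ) :
    (imageList H y₀ R ω n).length = n + 1 + ∑ c ∈ R, cost H ω n c := by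
  rw [imageList, List.length_append, List.length_singleton, List.length_flatMap,
    list_sum_map_range]
  simp_rw [length_block]
  rw [Finset.sum_add_distrib, Finset.sum_const, Finset.card_range, smul_eq_mul, mul_one,
    ← Finset.sum_filter]
  have hmaps : ∀ t ∈ (Finset.range n).filter (fun t => ω t 1 ≠ ω (t + 1) 1 ∧ cutOf ω t ∈ R),
      cutOf ω t ∈ R := fun t ht => (Finset.mem_filter.1 ht).2.2
  rw [← Finset.sum_fiberwise_of_maps_to hmaps]
  have hinner : ∀ c ∈ R,
      ∑ t ∈ ((Finset.range n).filter (fun t => ω t 1 ≠ ω (t + 1) 1 ∧ cutOf ω t ∈ R)).filter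
          (fun t => cutOf ω t = c), extra H ω n t = cost H ω n c := by
    intro c hc
    rw [cost, crossTimes_eq_filter hW c]
    refine Finset.sum_congr ?_ fun t _ => rfl
    ext t
    simp only [Finset.mem_filter, Finset.mem_range]
    constructor
    · rintro ⟨⟨ht, hne, -⟩, rfl⟩; exact ⟨ht, hne, rfl⟩
    · rintro ⟨ht, hne, rfl⟩; exact ⟨⟨ht, hne, hc⟩, rfl⟩
  rw [Finset.sum_congr rfl hinner]
  ring

/-- The number of crossings of a cut is at most `⌊(rightmost column)/2⌋ + 1`: distinct strands have distinct columns of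
the parity of the cut in `{0, …, rightmost}`. [cite: MadrasSlade1993, Theorem 8.2.1 (8.2.13), p. 269 (statement shape; lane construction)] -/
theorem card_crossTimes_le (hW : SlabWalk H ω n) {c : ℤ} {s : ℕ} (hs : s ∈ crossTimes ω n c)
    (htop : IsRight ω n c s) : (crossTimes ω n c).card ≤ (ω s 0).toNat / 2 + 1 := by
  have hpar : ∀ t ∈ crossTimes ω n c, (ω t 0 + c) % 2 = 0 := by
    intro t ht
    obtain ⟨htn, htc⟩ := mem_crossTimes.1 ht
    have h := crosses_cutOf_of_ne (hW.adj t htn) htc.ne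
    rw [htc.cutOf_eq] at h
    exact h.2.2
  have h := Finset.card_le_card_of_injOn (s := crossTimes ω n c) (t := Finset.range ((ω s 0).toNat / 2 + 1))
    (fun t => (ω t 0).toNat / 2) (fun t ht => ?_) (fun t ht t' ht' h => ?_)
  · simpa using h
  · have h1 := htop t ht
    have h0 := hW.col_nonneg t (mem_crossTimes.1 ht).1.le
    have h0' := hW.col_nonneg s (mem_crossTimes.1 hs).1.le
    simp only [Finset.coe_range, Set.mem_Iio]
    omega
  · have h0 := hW.col_nonneg t (mem_crossTimes.1 ht).1.le
    have h0' := hW.col_nonneg t' (mem_crossTimes.1 ht').1.le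
    have p1 := hpar t ht
    have p2 := hpar t' ht'
    exact crossTimes_col_inj hW.inj hW.cols ht ht' (by simp only at h; omega)

/-- **Cost bound**: each cut costs at most `2H + 4` extra steps (`4` per strand left of the rightmost one — at most
`⌊x*/2⌋` of them — and `2(H + 1 − x*) + 2` for the rightmost strand at column `x*`).
[cite: MadrasSlade1993, Theorem 8.2.1 (8.2.13), p. 269 (statement shape; lane construction)] -/
theorem cost_le (hW : SlabWalk H ω n) {c : ℤ} (hc : c ∈ cutsP ω n) : cost H ω n c ≤ 2 * H + 4 := by
  obtain ⟨s, hs, htop⟩ := exists_isRight hW.adj hc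
  have hsc : cutOf ω s = c := (mem_crossTimes.1 hs).2.cutOf_eq
  have huniq : ∀ t ∈ crossTimes ω n c, t ≠ s → ¬ IsRight ω n c t := by
    intro t ht hts h
    exact hts (crossTimes_col_inj hW.inj hW.cols ht hs (le_antisymm (htop t ht) (h s hs)))
  rw [cost, ← Finset.add_sum_erase _ _ hs]
  have h2 : ∑ t ∈ (crossTimes ω n c).erase s, extra H ω n t = 4 * ((crossTimes ω n c).card - 1) := by
    rw [Finset.sum_congr rfl fun t ht => ?_, Finset.sum_const, Finset.card_erase_of_mem hs,
      smul_eq_mul, mul_comm]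
    have htc : cutOf ω t = c := (mem_crossTimes.1 (Finset.mem_of_mem_erase ht)).2.cutOf_eq
    rw [extra, width, htc, if_neg (huniq t (Finset.mem_of_mem_erase ht) (Finset.ne_of_mem_erase ht))]
  rw [h2, extra, width, hsc, if_pos htop]
  have hk := card_crossTimes_le hW hs htop
  have hL := hW.col_le s (mem_crossTimes.1 hs).1.le
  have h0 := hW.col_nonneg s (mem_crossTimes.1 hs).1.le
  have e1 : ((((H : ℤ) + 1 - ω s 0).toNat : ℕ) : ℤ) = (H : ℤ) + 1 - ω s 0 := Int.toNat_of_nonneg (by omega)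
  have e2 : (((ω s 0).toNat : ℕ) : ℤ) = ω s 0 := Int.toNat_of_nonneg h0
  have hpos : 1 ≤ (crossTimes ω n c).card := Finset.card_pos.2 ⟨s, hs⟩
  omega

/-- There are at most `n` cuts. [cite: MadrasSlade1993, Theorem 8.2.1 (8.2.13), p. 269 (statement shape; lane construction)] -/
theorem card_cutsP_le (ω : ℕ → Site 2) (n : ℕ) : (cutsP ω n).card ≤ n := by
  unfold cutsP
  exact Finset.card_image_le.trans ((Finset.card_filter_le _ _).trans (by simp))

/-! ### Injectivity: recovering `ω` from the image (given `R`) -/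

section Good

open Classical in
/-- The Boolean test "the row of `z` is in the range of `σ`". [cite: MadrasSlade1993, Theorem 8.2.1 (8.2.13), p. 269 (statement shape; lane construction)] -/
def isGood (y₀ : ℤ) (R : Finset ℤ) (z : Site 2) : Bool := decide (∃ y, z 1 = rowMap y₀ R y)

open Classical in
/-- Anchors pass the test `isGood`. [cite: MadrasSlade1993, Theorem 8.2.1 (8.2.13), p. 269 (statement shape; lane construction)] -/
theorem isGood_vmap (y₀ : ℤ) (R : Finset ℤ) (p : Site 2) : isGood y₀ R (vmap y₀ R p) = true := by
  unfold isGood; exact decide_eq_true ⟨p 1, rfl⟩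

open Classical in
/-- Inserted points fail the test `isGood`. [cite: MadrasSlade1993, Theorem 8.2.1 (8.2.13), p. 269 (statement shape; lane construction)] -/
theorem isGood_eq_false {c : ℤ} (hc : c ∈ R) {z : Site 2}
    (hz : rowMap y₀ R c + 1 ≤ z 1 ∧ z 1 ≤ rowMap y₀ R c + 2) : isGood y₀ R z = false := by
  unfold isGood
  rw [decide_eq_false_iff_not]
  rintro ⟨y, hy⟩
  rw [hy] at hz
  exact rowMap_not_ins hc y hz

/-- Filtering a block to the rows in the range of `σ` leaves its anchor. [cite: MadrasSlade1993, Theorem 8.2.1 (8.2.13), p. 269 (statement shape; lane construction)] -/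
theorem filter_good_block (t : ℕ) :
    (block H y₀ R ω n t).filter (isGood y₀ R) = [vmap y₀ R (ω t)] := by
  have hcons : ∃ rest, block H y₀ R ω n t = vmap y₀ R (ω t) :: rest := by
    unfold block; split_ifs <;> exact ⟨_, rfl⟩
  obtain ⟨rest, hrest⟩ := hcons
  have hbad : ∀ z ∈ rest, ¬ isGood y₀ R z = true := by
    intro z hz
    have hz' : z ∈ block H y₀ R ω n t := by rw [hrest]; exact List.mem_cons_of_mem _ hz
    have hnd := nodup_block (H := H) y₀ R ω n t
    rw [hrest, List.nodup_cons] at hnd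
    rcases mem_block hz' with h | ⟨-, hRc, hrow, -, -⟩
    · exact absurd (h ▸ hz) hnd.1
    · rw [isGood_eq_false hRc hrow]; exact Bool.false_ne_true
  rw [hrest, List.filter_cons_of_pos (isGood_vmap y₀ R (ω t)), List.filter_eq_nil_iff.2 hbad]

/-- **Recovering `ω`**: the image points in the rows of `σ(ℤ)` are exactly the anchors `σ(ω 0), …, σ(ω n)`, in order.
[cite: MadrasSlade1993, Theorem 8.2.1 (8.2.13), p. 269 (statement shape; lane construction)] -/
theorem filter_good_imageList (ω : ℕ → Site 2) (n : ℕ) :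
    (imageList H y₀ R ω n).filter (isGood y₀ R) = (List.range (n + 1)).map fun t => vmap y₀ R (ω t) := by
  rw [imageList, List.filter_append, List.filter_flatMap,
    List.flatMap_congr fun t _ => filter_good_block (H := H) (y₀ := y₀) (R := R) (ω := ω) (n := n) t,
    ← List.map_eq_flatMap, List.filter_cons_of_pos (isGood_vmap y₀ R (ω n)),
    List.filter_nil, List.range_succ, List.map_append, List.map_singleton]

end Good

/-! ### Injectivity: recovering `R` from the image -/

/-- The inserted rows of `R`: `σ c + 1, σ c + 2` for `c ∈ R` (the rows of the image meeting the new column `H + 1`).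
[cite: MadrasSlade1993, Theorem 8.2.1 (8.2.13), p. 269 (statement shape; lane construction)] -/
def insRows (y₀ : ℤ) (R : Finset ℤ) : Finset ℤ :=
  R.biUnion fun c => {rowMap y₀ R c + 1, rowMap y₀ R c + 2}

/-- Membership in `insRows`. [cite: MadrasSlade1993, Theorem 8.2.1 (8.2.13), p. 269 (statement shape; lane construction)] -/
theorem mem_insRows {y : ℤ} :
    y ∈ insRows y₀ R ↔ ∃ c ∈ R, y = rowMap y₀ R c + 1 ∨ y = rowMap y₀ R c + 2 := by
  simp [insRows]

/-- No row of `σ(ℤ)` is an inserted row. [cite: MadrasSlade1993, Theorem 8.2.1 (8.2.13), p. 269 (statement shape; lane construction)] -/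
theorem rowMap_not_mem_insRows (y₀ : ℤ) (R : Finset ℤ) (y : ℤ) : rowMap y₀ R y ∉ insRows y₀ R := by
  rw [mem_insRows]
  rintro ⟨c, hc, h⟩
  exact rowMap_not_ins (y₀ := y₀) hc y (by omega)

/-- `y ∈ R` iff the row after `σ y` is an inserted row. [cite: MadrasSlade1993, Theorem 8.2.1 (8.2.13), p. 269 (statement shape; lane construction)] -/
theorem mem_iff_succ_mem_insRows (y : ℤ) : y ∈ R ↔ rowMap y₀ R y + 1 ∈ insRows y₀ R := by
  constructor
  · intro hy; exact mem_insRows.2 ⟨y, hy, Or.inl rfl⟩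
  · intro h
    by_contra hy
    rw [← rowMap_succ_of_not_mem hy] at h
    exact rowMap_not_mem_insRows y₀ R _ h

/-- `y ∈ R` iff the row before `σ(y+1)` is an inserted row. [cite: MadrasSlade1993, Theorem 8.2.1 (8.2.13), p. 269 (statement shape; lane construction)] -/
theorem mem_iff_pred_mem_insRows (y : ℤ) : y ∈ R ↔ rowMap y₀ R (y + 1) - 1 ∈ insRows y₀ R := by
  constructor
  · intro hy
    rw [rowMap_succ_of_mem hy]
    exact mem_insRows.2 ⟨y, hy, Or.inr (by ring)⟩
  · intro h
    by_contra hy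
    rw [rowMap_succ_of_not_mem hy, show rowMap y₀ R y + 1 - 1 = rowMap y₀ R y by ring] at h
    exact rowMap_not_mem_insRows y₀ R _ h

/-- `σ` is determined by its set of inserted rows (induction up and down from the base row).
[cite: MadrasSlade1993, Theorem 8.2.1 (8.2.13), p. 269 (statement shape; lane construction)] -/
theorem rowMap_eq_of_insRows_eq {R' : Finset ℤ} (h : insRows y₀ R = insRows y₀ R') (y : ℤ) :
    rowMap y₀ R y = rowMap y₀ R' y := by
  induction y using Int.inductionOn' with
  | b => exact y₀
  | zero => rw [rowMap_base, rowMap_base]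
  | succ k _ ih =>
    have hm : k ∈ R ↔ k ∈ R' := by
      rw [mem_iff_succ_mem_insRows (y₀ := y₀) (R := R), mem_iff_succ_mem_insRows (y₀ := y₀) (R := R'), ih, h]
    rw [rowMap_succ, rowMap_succ, ih]
    by_cases hk : k ∈ R
    · rw [if_pos hk, if_pos (hm.1 hk)]
    · rw [if_neg hk, if_neg (fun h' => hk (hm.2 h'))]
  | pred k _ ih =>
    have e1 := rowMap_succ y₀ R (k - 1)
    have e2 := rowMap_succ y₀ R' (k - 1)
    rw [sub_add_cancel] at e1 e2
    have hm : (k - 1) ∈ R ↔ (k - 1) ∈ R' := by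
      rw [mem_iff_pred_mem_insRows (y₀ := y₀) (R := R), mem_iff_pred_mem_insRows (y₀ := y₀) (R := R'),
        sub_add_cancel, ih, h]
    by_cases hk : (k - 1) ∈ R
    · rw [if_pos hk] at e1; rw [if_pos (hm.1 hk)] at e2; omega
    · rw [if_neg hk] at e1; rw [if_neg (fun h' => hk (hm.2 h'))] at e2; omega

/-- **Recovering `R`**: the set of inserted rows determines `R`. [cite: MadrasSlade1993, Theorem 8.2.1 (8.2.13), p. 269 (statement shape; lane construction)] -/
theorem insRows_injective {R' : Finset ℤ} (h : insRows y₀ R = insRows y₀ R') : R = R' := by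
  ext y
  rw [mem_iff_succ_mem_insRows (y₀ := y₀) (R := R) y, mem_iff_succ_mem_insRows (y₀ := y₀) (R := R') y,
    rowMap_eq_of_insRows_eq h y, h]

/-- The rows of the points of a list in the new column `H + 1`. [cite: MadrasSlade1993, Theorem 8.2.1 (8.2.13), p. 269 (statement shape; lane construction)] -/
def wideRows (H : ℕ) (l : List (Site 2)) : Finset ℤ :=
  (l.toFinset.filter fun z => z 0 = (H : ℤ) + 1).image fun z => z 1

/-- Membership in `wideRows`. [cite: MadrasSlade1993, Theorem 8.2.1 (8.2.13), p. 269 (statement shape; lane construction)] -/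
theorem mem_wideRows {l : List (Site 2)} {y : ℤ} :
    y ∈ wideRows H l ↔ ∃ z ∈ l, z 0 = (H : ℤ) + 1 ∧ z 1 = y := by
  simp [wideRows, and_assoc]

/-- **The rows of the image meeting the new column are exactly the inserted rows** (for `R ⊆ cuts`).
[cite: MadrasSlade1993, Theorem 8.2.1 (8.2.13), p. 269 (statement shape; lane construction)] -/
theorem wideRows_imageList (hW : SlabWalk H ω n) (hR : R ⊆ cutsP ω n) :
    wideRows H (imageList H y₀ R ω n) = insRows y₀ R := by
  ext y
  rw [mem_wideRows, mem_insRows]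
  constructor
  · rintro ⟨z, hz, hz0, rfl⟩
    rw [imageList, List.mem_append, List.mem_flatMap, List.mem_singleton] at hz
    rcases hz with ⟨t, ht, hzt⟩ | rfl
    · have ht' := List.mem_range.1 ht
      rcases mem_block hzt with rfl | ⟨hne, hRc, hrow, hc1, hc2⟩
      · have := hW.col_le t ht'.le
        simp at hz0; omega
      · have hw := col_add_width hW ht'.le
        exact ⟨_, hRc, by omega⟩
    · have := hW.col_le n le_rfl
      simp at hz0; omega
  · rintro ⟨c, hc, hy⟩
    obtain ⟨s, hs, htop⟩ := exists_isRight hW.adj (hR hc)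
    obtain ⟨hsn, hsc⟩ := mem_crossTimes.1 hs
    have hne := hsc.ne
    have hcut := hsc.cutOf_eq
    have hw := col_add_width hW hsn.le
    rw [hcut] at hw
    have hws := hw.2.2.1 htop
    -- the block of the rightmost crossing contains the two far points of its U-turn
    have hut : ∀ z ∈ uturn (ω s 0) (rowMap y₀ R c) (width H ω n s), z ∈ block H y₀ R ω n s := by
      intro z hz
      unfold block
      rw [if_pos ⟨hne, hcut.symm ▸ hc⟩, hcut]
      refine List.mem_cons_of_mem _ ?_
      split_ifs
      · exact hz
      · exact List.mem_reverse.2 hz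
    have hmem : ∀ z ∈ block H y₀ R ω n s, z ∈ imageList H y₀ R ω n := fun z hz => by
      rw [imageList, List.mem_append, List.mem_flatMap]
      exact Or.inl ⟨s, List.mem_range.2 hsn, hz⟩
    obtain ⟨j, hj1, hj2, hyj⟩ : ∃ j : ℕ, 1 ≤ j ∧ j ≤ 2 ∧ y = rowMap y₀ R c + (j : ℤ) := by
      rcases hy with h | h
      · exact ⟨1, le_rfl, by norm_num, by simpa using h⟩
      · exact ⟨2, by norm_num, le_rfl, by simpa using h⟩
    refine ⟨mk (ω s 0 + (width H ω n s : ℕ)) (rowMap y₀ R c + (j : ℤ)),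
      hmem _ (hut _ (far_mem_uturn _ _ _ hj1 hj2)), ?_, ?_⟩
    · simp only [StripInsertion.mk_zero]; omega
    · simp only [StripInsertion.mk_one]; exact hyj.symm

/-- **Injectivity of `(ω, R) ↦ Ψ(ω, R)`** on slab walks with `R ⊆ cuts(ω)` (list form). [cite: MadrasSlade1993, Theorem 8.2.1 (8.2.13), p. 269 (statement shape; lane construction)] -/
theorem imageList_inj {ω' : ℕ → Site 2} {R' : Finset ℤ} (hW : SlabWalk H ω n)
    (hW' : SlabWalk H ω' n) (hR : R ⊆ cutsP ω n) (hR' : R' ⊆ cutsP ω' n)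
    (h : imageList H y₀ R ω n = imageList H y₀ R' ω' n) : R = R' ∧ ∀ t ≤ n, ω t = ω' t := by
  classical
  have hRR : R = R' := by
    apply insRows_injective (y₀ := y₀)
    rw [← wideRows_imageList hW hR, ← wideRows_imageList hW' hR', h]
  subst hRR
  refine ⟨rfl, fun t ht => ?_⟩
  have hf := filter_good_imageList (H := H) (y₀ := y₀) (R := R) ω n
  rw [h, filter_good_imageList ω' n] at hf
  have := List.map_inj_left.1 hf.symm t (List.mem_range.2 (Nat.lt_succ_of_le ht))
  exact vmap_injective y₀ R this

/-- **Injectivity of `Ψ`** (function form): equal images force `R = R'` and `ω = ω'` on `[0, n]`.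
[cite: MadrasSlade1993, Theorem 8.2.1 (8.2.13), p. 269 (statement shape; lane construction)] -/
theorem psi_inj {ω' : ℕ → Site 2} {R' : Finset ℤ} (hW : SlabWalk H ω n)
    (hW' : SlabWalk H ω' n) (h0 : ω 0 = ω' 0) (hR : R ⊆ cutsP ω n) (hR' : R' ⊆ cutsP ω' n)
    (hlen : (imageList H (ω 0 1) R ω n).length = (imageList H (ω' 0 1) R' ω' n).length)
    (h : psi H R ω n = psi H R' ω' n) : R = R' ∧ ∀ t ≤ n, ω t = ω' t := by
  rw [h0] at hlen
  refine imageList_inj (y₀ := ω' 0 1) hW hW' hR hR' (ofList_inj hlen fun s => ?_)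
  have := congrFun h s
  simp only [psi, h0] at this
  exact sub_left_inj.1 this

/-! ### From `slabPairs` to slab walks -/

/-- The placed walk of a pair of `slabPairs H n` is a slab walk from its starting site. [cite: MadrasSlade1993, Theorem 8.2.1 (8.2.13), p. 269 (statement shape; lane construction)] -/
theorem slabWalk_of_mem {p : Site 2 × (ℕ → Site 2)} (hp : p ∈ slabPairs H n) :
    SlabWalk H (fun t => p.1 + p.2 t) n ∧ p.1 + p.2 0 = p.1 := by
  obtain ⟨-, hυ, hbw, hin⟩ := mem_slabPairs.1 hp
  obtain ⟨h0, -, -, hinj⟩ := Zd.mem_saws.1 hυ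
  exact ⟨⟨hbw, fun t ht t' ht' h => hinj ht ht' (add_left_cancel h), fun t ht => (hin t ht).1,
    fun t ht => (hin t ht).2⟩, by simp [h0]⟩

/-- The tree's `HexBW.slabCuts a υ n` is `cutsP` of the placed walk. [cite: MadrasSlade1993, Theorem 8.2.1 (8.2.13), p. 269 (statement shape; lane construction)] -/
theorem cutsP_eq (a : Site 2) (υ : ℕ → Site 2) (n : ℕ) : cutsP (fun t => a + υ t) n = slabCuts a υ n := rfl

end SlabInsertion

/-! ### The insertion `Ψ` and its cost, over `slabPairs` / `admissibleSlabCuts` (the three hypotheses of the core) -/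

section Insertion

open StripInsertion SlabInsertion

variable {H n : ℕ}

/-- **The double-row insertion `Ψ`** of the door «HEX-ARMCHAIR-SLAB-SUBCRIT»: for a pair `p = (a, υ) ∈ slabPairs H n` and a set
`R` of parity-admissible row cuts of the placed walk `t ↦ a + υ t`, the pair `(a, Ψ)` of the same start and the translate of the
image walk. [cite: MadrasSlade1993, Theorem 8.2.1 (8.2.13), p. 269 (statement shape; lane construction)] -/
def slabInsertion (H n : ℕ) (p : Site 2 × (ℕ → Site 2)) (R : Finset ℤ) : Site 2 × (ℕ → Site 2) :=
  (p.1, SlabInsertion.psi H R (fun t => p.1 + p.2 t) n)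

/-- **The cost of a cut** under the insertion: the extra length contributed by the strands crossing the cut.
[cite: MadrasSlade1993, Theorem 8.2.1 (8.2.13), p. 269 (statement shape; lane construction)] -/
def slabInsertionCost (H n : ℕ) (p : Site 2 × (ℕ → Site 2)) (c : ℤ) : ℕ :=
  SlabInsertion.cost H (fun t => p.1 + p.2 t) n c

/-- The insertion keeps the starting site. [cite: MadrasSlade1993, Theorem 8.2.1 (8.2.13), p. 269 (statement shape; lane construction)] -/
@[simp] theorem slabInsertion_fst (H n : ℕ) (p : Site 2 × (ℕ → Site 2)) (R : Finset ℤ) :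
    (slabInsertion H n p R).1 = p.1 := rfl

/-- **(hcost) Each cut costs at most `2H + 4` extra steps.** [cite: MadrasSlade1993, Theorem 8.2.1 (8.2.13), p. 269 (statement shape; lane construction)] -/
theorem slabInsertionCost_le (n : ℕ) (p : Site 2 × (ℕ → Site 2)) (hp : p ∈ slabPairs H n) (c : ℤ)
    (hc : c ∈ admissibleSlabCuts H p.1 p.2 n) : slabInsertionCost H n p c ≤ 2 * H + 4 :=
  SlabInsertion.cost_le (slabWalk_of_mem hp).1
    (by rw [SlabInsertion.cutsP_eq]; exact (mem_admissibleSlabCuts.1 hc).1)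

/-- **(hmem) The image is a self-avoiding walk of the wider slab `Slab_{H+1}` from the same start, of length
`n + Σ_{c ∈ R} cost(c)`.** [cite: MadrasSlade1993, Theorem 8.2.1 (8.2.13), p. 269 (statement shape; lane construction)] -/
theorem slabInsertion_mem (n : ℕ) (p : Site 2 × (ℕ → Site 2)) (R : Finset ℤ) (hp : p ∈ slabPairs H n)
    (hR : R ⊆ admissibleSlabCuts H p.1 p.2 n) :
    slabInsertion H n p R ∈ slabPairs (H + 1) (n + ∑ c ∈ R, slabInsertionCost H n p c) := by
  obtain ⟨hW, h0⟩ := slabWalk_of_mem hp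
  have hRad : ∀ c ∈ R, (c + (H : ℤ)) % 2 = 0 := fun c hc => (mem_admissibleSlabCuts.1 (hR hc)).2
  obtain ⟨hs, hbw, hin⟩ := SlabInsertion.psi_spec (R := R) hW hRad
  have hlen : (SlabInsertion.imageList H ((p.1 + p.2 0) 1) R (fun t => p.1 + p.2 t) n).length - 1 =
      n + ∑ c ∈ R, slabInsertionCost H n p c := by
    rw [SlabInsertion.length_imageList hW]; unfold slabInsertionCost; omega
  rw [hlen] at hs hbw hin
  simp only [h0] at hbw hin
  exact mem_slabPairs.2 ⟨slabStarts_mono (Nat.le_succ H) (mem_slabPairs.1 hp).1, hs, hbw, hin⟩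

/-- **(hinj) The insertion is injective on the pairs (walk, subset of its admissible cuts).**
[cite: MadrasSlade1993, Theorem 8.2.1 (8.2.13), p. 269 (statement shape; lane construction)] -/
theorem slabInsertion_injOn (H n : ℕ) :
    Set.InjOn (fun q : (Σ _ : Site 2 × (ℕ → Site 2), Finset ℤ) => slabInsertion H n q.1 q.2)
      {q | q.1 ∈ slabPairs H n ∧ q.2 ⊆ admissibleSlabCuts H q.1.1 q.1.2 n} := by
  rintro ⟨p, R⟩ ⟨hp, hR⟩ ⟨p', R'⟩ ⟨hp', hR'⟩ h
  dsimp only at hp hR hp' hR' h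
  obtain ⟨hW, h0⟩ := slabWalk_of_mem hp
  obtain ⟨hW', h0'⟩ := slabWalk_of_mem hp'
  have h' := h
  simp only [slabInsertion, Prod.mk.injEq] at h'
  obtain ⟨ha, hψ⟩ := h'
  have hm := slabInsertion_mem n p R hp hR
  have hm' := slabInsertion_mem n p' R' hp' hR'
  rw [h] at hm
  have hlen := eq_of_mem_saws_of_mem_saws (mem_slabPairs.1 hm).2.1 (mem_slabPairs.1 hm').2.1
  have hlen' : (SlabInsertion.imageList H ((p.1 + p.2 0) 1) R (fun t => p.1 + p.2 t) n).length =
      (SlabInsertion.imageList H ((p'.1 + p'.2 0) 1) R' (fun t => p'.1 + p'.2 t) n).length := by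
    rw [SlabInsertion.length_imageList hW, SlabInsertion.length_imageList hW']
    unfold slabInsertionCost at hlen
    omega
  have hcR : R ⊆ SlabInsertion.cutsP (fun t => p.1 + p.2 t) n := fun c hc => by
    rw [SlabInsertion.cutsP_eq]; exact (mem_admissibleSlabCuts.1 (hR hc)).1
  have hcR' : R' ⊆ SlabInsertion.cutsP (fun t => p'.1 + p'.2 t) n := fun c hc => by
    rw [SlabInsertion.cutsP_eq]; exact (mem_admissibleSlabCuts.1 (hR' hc)).1
  obtain ⟨hRR, hω⟩ := SlabInsertion.psi_inj hW hW' (by rw [h0, h0', ha]) hcR hcR' hlen' hψ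
  have hυ : p.2 = p'.2 := by
    obtain ⟨-, he, -, -⟩ := Zd.mem_saws.1 (mem_slabPairs.1 hp).2.1
    obtain ⟨-, he', -, -⟩ := Zd.mem_saws.1 (mem_slabPairs.1 hp').2.1
    funext t
    rcases le_or_gt t n with ht | ht
    · have := hω t ht; rw [ha] at this; exact add_left_cancel this
    · rw [he t ht.le, he' t ht.le]
      have := hω n le_rfl; rw [ha] at this; exact add_left_cancel this
  have hpp : p = p' := Prod.ext ha hυ
  subst hpp; subst hRR; rfl

/-- **The insertion on `insDom`-style pairs** (the binder shape of `HexBW.slab_core_of_insertion`).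
[cite: MadrasSlade1993, Theorem 8.2.1 (8.2.13), p. 269 (statement shape; lane construction)] -/
theorem slabInsertion_injOn_insDom (H n : ℕ) :
    Set.InjOn (fun q : (Σ _ : Site 2 × (ℕ → Site 2), Finset ℤ) => slabInsertion H n q.1 q.2) ↑(slabInsDom H n) :=
  (slabInsertion_injOn H n).mono fun _ hq => mem_slabInsDom.1 (Finset.mem_coe.1 hq)

end Insertion

end Literature.Probability.RandomPlanarGeometry.SAW.HexBW
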